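import Literature.MathematicalPhysics.QuantumLattice.TwistedMassDeterminant
import Literature.MathematicalPhysics.QuantumLattice.GrassmannIntegralWilsonProofs
import HarnessLib

/-!
# The twisted-mass doublet `D_W + iμ_q γ₅ τ³` of the tree's Wilson–Dirac operator has a positive
# determinant on every gauge field (Frezzotti–Grassi–Sint–Weisz), and its Hasenbusch / Lüscher–Palombi
# factors

Topic `MathematicalPhysics/QuantumLattice`; sequel of `TwistedMassDeterminant.lean` (one abstract
`γ₅`-Hermitian matrix) which it instantiates for the tree's gauge-covariant Wilson–Dirac operator
`wilsonDirac ρ U m r` on the four-torus (`GrassmannIntegral.lean`; colour representation `ρ` unitary,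
gauge group arbitrary), whose `γ₅`-hermiticity `γ₅ D_W γ₅ = D_W†` is the tree theorem
`wilsonDirac_gammaFive_hermitian_holds` (`GrassmannIntegralWilsonProofs.lean`, Montvay–Münster (4.35)).

PUBLISHED RESULTS formalised (statements as printed, now for every lattice gauge field `U`):

* R. Frezzotti, P. A. Grassi, S. Sint, P. Weisz, Nucl. Phys. B (Proc. Suppl.) 83 (2000) 941 =
  hep-lat/9909003, §1: (1.1) "`D_twist ≡ D_W + iμ_q γ₅ τ³` … (the Pauli matrix `τ³` acts in flavour
  space)", (1.2) "It is obvious that this lattice Dirac operator is protected against zero modes for any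
  finite value of `μ_q`, `det D_twist = det(D_W† D_W + μ_q²) > 0`"; JHEP 08 (2001) 058 = hep-lat/0101001
  §1 (1.1): `D_tmQCD = D_W + m₀ + iμ_qγ₅τ³` "protects the Dirac operator against zero modes,
  independently of the background gauge field" — `twistedDoublet` (the flavour-block form
  `diag(D + iμγ₅, D − iμγ₅) = D ⊗ 1 + iμ γ₅ ⊗ τ³`, `twistedDoublet_eq`), `det_twistedDoublet`
  (= `det(D†D + μ²)` for any `γ₅`-Hermitian `D`), and for the Wilson operator
  `det_wilsonTwistedDoublet`, `det_wilsonTwistedDoublet_pos`, `posDef_wilson_tmKernel`.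
* C. Urbach, K. Jansen, A. Shindler, U. Wenger, Comput. Phys. Commun. 174 (2006) 87 = hep-lat/0506011
  §3–§4: "`W± = Q ± iμ`", "`W⁺W⁻ = Q² + μ²`", §4 "`W±_j = γ₅(D_W[U,m₀] ± iμ_jγ₅)`" —
  `isHermitian_gammaFive_mul_wilsonDirac` (`Q = γ₅ D_W` Hermitian for ANY unitary `ρ`; the tree's
  `Multiboson.isHermitian_gammaFive_mul_wilsonDirac_fundamental` is the `SU(3)`-fundamental case),
  `conjTranspose_wilsonTwisted_mul_self` (`W⁺_j†W⁺_j`-type identity `(D_W + iμγ₅)†(D_W + iμγ₅) = D_W†D_W + μ²`).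
* M. Lüscher, F. Palombi, PoS(LATTICE 2008)049, (2.1) "`det(D†D) = W det(D̃†D̃)`" with `D̃₁ = D + iμγ₅`
  (Table 1) — `det_wilson_eq_rwFactor₁_mul_det` (per gauge field; `W₁(U) ∈ [0, 1]`:
  `wilson_rwFactor₁_mem_Icc`).

HONEST SCOPE: as in the parent file — one gauge field at a time, no statement about ensembles,
fluctuations of `W₁(U)` over `U`, forces or costs; `r`, `m`, `L ≥ 1`, the gauge group and the unitary
colour representation are arbitrary.  Cell pub-lqcd (venture `LatticeQCDFlow`), HOME/R2-SCOPE.md §3 E3/E4,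
FANOUT row 38.  No named fact is introduced (D-0026).

## References
* [FrezzottiEtAl2000ZeroModes] Frezzotti–Grassi–Sint–Weisz, Nucl. Phys. B (Proc. Suppl.) 83 (2000) 941,
  §1 (1.1)–(1.2).
* [FrezzottiEtAl2001tmQCD] Frezzotti–Grassi–Sint–Weisz, JHEP 08 (2001) 058, §1 (1.1).
* [UrbachEtAl2006] Urbach–Jansen–Shindler–Wenger, Comput. Phys. Commun. 174 (2006) 87, §3, §4.
* [LuscherPalombi2008] Lüscher–Palombi, PoS(LATTICE 2008)049, (2.1)–(2.2), Table 1.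
* [MontvayMunster1994] Montvay–Münster, Quantum Fields on a Lattice, CUP 1994, §4.2 (4.35)
  (γ₅-hermiticity, through `wilsonDirac_gammaFive_hermitian_holds`).
-/

namespace Literature.MathematicalPhysics.QuantumLattice.TwistedMass

open Matrix
open scoped MatrixOrder ComplexOrder BigOperators

/-! ## §1 The flavour doublet `diag(D + iμγ₅, D − iμγ₅) = D ⊗ 1 + iμ γ₅ ⊗ τ³` (any `γ₅`-Hermitian `D`) -/

section Doublet

variable {ι : Type} [Fintype ι] [DecidableEq ι] {γ D : Matrix ι ι ℂ}

/-- **The twisted-mass doublet** `D_twist = D_W + iμ_qγ₅τ³` (FGSW (1.1)) as a `2 × 2` flavour-block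
matrix: `τ³ = diag(1, −1)` in flavour space, so `D_twist = diag(D + iμγ₅, D − iμγ₅)` with the two
components `twistedDirac γ D (±μ)` of the parent file.
[cite: FrezzottiEtAl2000ZeroModes, §1 eq. (1.1)] [cite: FrezzottiEtAl2001tmQCD, §1 eq. (1.1)] -/
def twistedDoublet (γ D : Matrix ι ι ℂ) (μ : ℝ) : Matrix (ι ⊕ ι) (ι ⊕ ι) ℂ :=
  Matrix.fromBlocks (twistedDirac γ D μ) 0 0 (twistedDirac γ D (-μ))

omit [Fintype ι] [DecidableEq ι] in
/-- Unfolding lemma for `twistedDoublet`. [cite: FrezzottiEtAl2000ZeroModes, §1 eq. (1.1)] -/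
theorem twistedDoublet_def (γ D : Matrix ι ι ℂ) (μ : ℝ) :
    twistedDoublet γ D μ = Matrix.fromBlocks (twistedDirac γ D μ) 0 0 (twistedDirac γ D (-μ)) := rfl

omit [Fintype ι] [DecidableEq ι] in
/-- **`D_twist = D ⊗ 1_flavour + iμ (γ₅ ⊗ τ³)`**: the block form IS "`D_W + iμ_qγ₅τ³`" with
`τ³ = diag(1, −1)` acting in flavour space. [cite: FrezzottiEtAl2000ZeroModes, §1 eq. (1.1)] -/
theorem twistedDoublet_eq (γ D : Matrix ι ι ℂ) (μ : ℝ) :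
    twistedDoublet γ D μ =
      Matrix.fromBlocks D 0 0 D + ((μ : ℂ) * Complex.I) • Matrix.fromBlocks γ 0 0 (-γ) := by
  rw [twistedDoublet, twistedDirac, twistedDirac, Matrix.fromBlocks_smul, Matrix.fromBlocks_add,
    smul_zero, add_zero, Complex.ofReal_neg, neg_mul, neg_smul, smul_neg]

/-- **FGSW (1.2), verbatim: `det D_twist = det(D_W†D_W + μ_q²)`** — for every `γ₅`-Hermitian `D`
(`D† = γ₅Dγ₅`, `γ₅† = γ₅`, `γ₅² = 1`) the determinant of the doublet is the determinant of the
twisted-mass kernel `D†D + μ²` (block-diagonal determinant = product of the two flavour determinants =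
`det_twistedDirac_mul_det_twistedDirac_neg`). [cite: FrezzottiEtAl2000ZeroModes, §1 eq. (1.2)] -/
theorem det_twistedDoublet (hγ : γᴴ = γ) (hγγ : γ * γ = 1) (hD : Dᴴ = γ * D * γ) (μ : ℝ) :
    (twistedDoublet γ D μ).det = (tmKernel D μ).det := by
  rw [twistedDoublet, Matrix.det_fromBlocks_zero₂₁, det_twistedDirac_mul_det_twistedDirac_neg hγ hγγ hD,
    tmKernel_def]

/-- **FGSW (1.2), the inequality: `det D_twist > 0`** for `μ ≠ 0` — a positive real, for every
`γ₅`-Hermitian `D` ("protected against zero modes for any finite value of `μ_q`").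
[cite: FrezzottiEtAl2000ZeroModes, §1 eq. (1.2)] [cite: FrezzottiEtAl2001tmQCD, §1 eq. (1.1)] -/
theorem det_twistedDoublet_pos (hγ : γᴴ = γ) (hγγ : γ * γ = 1) (hD : Dᴴ = γ * D * γ) {μ : ℝ}
    (hμ : μ ≠ 0) :
    0 < (twistedDoublet γ D μ).det.re ∧ (twistedDoublet γ D μ).det.im = 0 := by
  rw [det_twistedDoublet hγ hγγ hD]
  exact det_tmKernel_pos D hμ

/-- At `μ = 0` the doublet is two copies of `D` and `det D_twist = det(D†D) = |det D|² ≥ 0`.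
[cite: FrezzottiEtAl2000ZeroModes, §1 eq. (1.2)] -/
theorem det_twistedDoublet_nonneg (hγ : γᴴ = γ) (hγγ : γ * γ = 1) (hD : Dᴴ = γ * D * γ) (μ : ℝ) :
    0 ≤ (twistedDoublet γ D μ).det.re ∧ (twistedDoublet γ D μ).det.im = 0 := by
  rw [det_twistedDoublet hγ hγγ hD]
  exact det_tmKernel_nonneg D μ

end Doublet

/-! ## §2 The instance: the tree's Wilson–Dirac operator `wilsonDirac ρ U m r` -/

section Wilson

open Literature.Probability.LatticeModels Literature.MathematicalPhysics.QuantumFieldTheory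

variable {L N : ℕ} {G : Type*} [Group G] (ρ : G →* Matrix (Fin N) (Fin N) ℂ)

/-- The spin lift `Γ₅ = 1_Λ ⊗ 1_N ⊗ γ₅` of `γ₅` is Hermitian (it is the real diagonal sign matrix
`diag(1,1,−1,−1)` on the spin index). [cite: MontvayMunster1994, §4.2 (4.35) and App. A (γ₅ Hermitian)] -/
theorem conjTranspose_spinorLift_gammaFive :
    (spinorLift gammaFive :
        Matrix (TorusSite 4 L × Fin N × Fin 4) (TorusSite 4 L × Fin N × Fin 4) ℂ)ᴴ =
      spinorLift gammaFive := by
  rw [spinorLift_gammaFive_eq_diagonal, Matrix.diagonal_conjTranspose]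
  congr 1
  funext p
  obtain ⟨x, a, α⟩ := p
  fin_cases α <;> simp

/-- **γ₅-hermiticity in the parent file's form**: `D_W† = Γ₅ D_W Γ₅` for unitary `ρ`, every gauge field
`U`, every `m`, `r` (the tree's `wilsonDirac_gammaFive_hermitian_holds`, Montvay–Münster (4.35)).
[cite: MontvayMunster1994, §4.2 (4.35)] -/
theorem conjTranspose_wilsonDirac [NeZero L] (hρ : ∀ g, ρ g ∈ Matrix.unitaryGroup (Fin N) ℂ)
    (U : GaugeConfig 4 L G) (m r : ℝ) :
    (wilsonDirac ρ U m r)ᴴ = spinorLift gammaFive * wilsonDirac ρ U m r * spinorLift gammaFive :=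
  (wilsonDirac_gammaFive_hermitian_holds ρ hρ U m r).symm

/-- **`Q = γ₅ D_W` is Hermitian** for ANY unitary colour representation and every gauge field (Urbach et
al.'s Hermitian `Q`; the tree's `isHermitian_gammaFive_mul_wilsonDirac_fundamental` is the
`SU(3)`-fundamental instance). [cite: UrbachEtAl2006, §3 (W± = Q ± iμ, Q = γ₅D)] -/
theorem isHermitian_gammaFive_mul_wilsonDirac [NeZero L] (hρ : ∀ g, ρ g ∈ Matrix.unitaryGroup (Fin N) ℂ)
    (U : GaugeConfig 4 L G) (m r : ℝ) :
    (spinorLift gammaFive * wilsonDirac ρ U m r).IsHermitian :=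
  isHermitian_hermQ conjTranspose_spinorLift_gammaFive spinorLift_gammaFive_mul_self
    (conjTranspose_wilsonDirac ρ hρ U m r)

/-- **`W⁺†W⁺ = Q² + μ²` for the Wilson operator**: `(D_W + iμΓ₅)†(D_W + iμΓ₅) = D_W†D_W + μ²` on every
gauge field (Urbach et al. §3 "`W⁺W⁻ = Q² + μ²`", §4 "`W±_j = γ₅(D_W[U,m₀] ± iμ_jγ₅)`"; Lüscher–Palombi:
"`det(D̃₁†D̃₁)` … coincides with the quark determinant in twisted-mass QCD").
[cite: UrbachEtAl2006, §3 ('W⁺W⁻ = Q² + μ²') and §4 (W±_j)] [cite: LuscherPalombi2008, §2 (after (2.2))] -/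
theorem conjTranspose_wilsonTwisted_mul_self [NeZero L]
    (hρ : ∀ g, ρ g ∈ Matrix.unitaryGroup (Fin N) ℂ) (U : GaugeConfig 4 L G) (m r μ : ℝ) :
    (twistedDirac (spinorLift gammaFive) (wilsonDirac ρ U m r) μ)ᴴ *
        twistedDirac (spinorLift gammaFive) (wilsonDirac ρ U m r) μ =
      tmKernel (wilsonDirac ρ U m r) μ :=
  conjTranspose_twistedDirac_mul_self conjTranspose_spinorLift_gammaFive spinorLift_gammaFive_mul_self
    (conjTranspose_wilsonDirac ρ hρ U m r) μ

/-- **FGSW (1.2) for the Wilson–Dirac operator, every gauge field**: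
`det(D_W + iμΓ₅τ³) = det(D_W†D_W + μ²)` (the doublet built on `wilsonDirac ρ U m r`, which already
contains the bare mass `m`; `r` the Wilson parameter). [cite: FrezzottiEtAl2000ZeroModes, §1 eq. (1.2)] -/
theorem det_wilsonTwistedDoublet [NeZero L] (hρ : ∀ g, ρ g ∈ Matrix.unitaryGroup (Fin N) ℂ)
    (U : GaugeConfig 4 L G) (m r μ : ℝ) :
    (twistedDoublet (spinorLift gammaFive) (wilsonDirac ρ U m r) μ).det =
      (tmKernel (wilsonDirac ρ U m r) μ).det :=
  det_twistedDoublet conjTranspose_spinorLift_gammaFive spinorLift_gammaFive_mul_self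
    (conjTranspose_wilsonDirac ρ hρ U m r) μ

/-- **"protected against zero modes, independently of the background gauge field"**: for `μ ≠ 0`,
`det(D_W + iμΓ₅τ³) > 0` (a positive real) for EVERY gauge field `U`, every bare mass `m` and Wilson
parameter `r`, every unitary colour representation.
[cite: FrezzottiEtAl2000ZeroModes, §1 eq. (1.2)] [cite: FrezzottiEtAl2001tmQCD, §1 eq. (1.1)] -/
theorem det_wilsonTwistedDoublet_pos [NeZero L] (hρ : ∀ g, ρ g ∈ Matrix.unitaryGroup (Fin N) ℂ)
    (U : GaugeConfig 4 L G) (m r : ℝ) {μ : ℝ} (hμ : μ ≠ 0) :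
    0 < (twistedDoublet (spinorLift gammaFive) (wilsonDirac ρ U m r) μ).det.re ∧
      (twistedDoublet (spinorLift gammaFive) (wilsonDirac ρ U m r) μ).det.im = 0 :=
  det_twistedDoublet_pos conjTranspose_spinorLift_gammaFive spinorLift_gammaFive_mul_self
    (conjTranspose_wilsonDirac ρ hρ U m r) hμ

/-- The twisted-mass kernel `D_W†D_W + μ²` of the Wilson operator is positive definite with gap `μ²` on
every gauge field (no hypothesis on `ρ`: this half needs no γ₅-hermiticity).
[cite: FrezzottiEtAl2001tmQCD, §1 eq. (1.1)] -/
theorem posDef_wilson_tmKernel [NeZero L] (U : GaugeConfig 4 L G) (m r : ℝ) {μ : ℝ} (hμ : μ ≠ 0) :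
    (tmKernel (wilsonDirac ρ U m r) μ).PosDef :=
  posDef_tmKernel _ hμ

/-- The spectral gap for the Wilson operator: every eigenvalue of `D_W†D_W + μ²` is `≥ μ²`, on every
gauge field. [cite: FrezzottiEtAl2001tmQCD, §1 eq. (1.1)] -/
theorem spectrum_wilson_tmKernel_ge [NeZero L] (U : GaugeConfig 4 L G) (m r μ : ℝ) {x : ℝ}
    (hx : x ∈ spectrum ℝ (tmKernel (wilsonDirac ρ U m r) μ)) : μ ^ 2 ≤ x :=
  spectrum_tmKernel_ge _ μ hx

/-- **Lüscher–Palombi (2.1) for the Wilson operator**: on every gauge field,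
`det(D_W†D_W) = W₁(U) · det(D̃₁†D̃₁)` with `D̃₁ = D_W + iμΓ₅` and `W₁(U) = det[D_W†D_W/(D_W†D_W + μ²)]`
(`μ ≠ 0`). [cite: LuscherPalombi2008, eq. (2.1) and Table 1 (l = 1)] -/
theorem det_wilson_eq_rwFactor₁_mul_det [NeZero L] (hρ : ∀ g, ρ g ∈ Matrix.unitaryGroup (Fin N) ℂ)
    (U : GaugeConfig 4 L G) (m r : ℝ) {μ : ℝ} (hμ : μ ≠ 0) :
    ((wilsonDirac ρ U m r)ᴴ * wilsonDirac ρ U m r).det.re =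
      rwFactor₁ (wilsonDirac ρ U m r) μ *
        ((twistedDirac (spinorLift gammaFive) (wilsonDirac ρ U m r) μ)ᴴ *
          twistedDirac (spinorLift gammaFive) (wilsonDirac ρ U m r) μ).det.re :=
  det_eq_rwFactor₁_mul_det conjTranspose_spinorLift_gammaFive spinorLift_gammaFive_mul_self
    (conjTranspose_wilsonDirac ρ hρ U m r) hμ

/-- The Wilson reweighting factor satisfies `0 ≤ W₁(U) ≤ 1` on every gauge field: reweighting from the
twisted-mass ensemble to `μ = 0` never up-weights a configuration. [cite: LuscherPalombi2008, eqs. (2.1)–(2.2)] -/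
theorem wilson_rwFactor₁_mem_Icc [NeZero L] (U : GaugeConfig 4 L G) (m r μ : ℝ) :
    rwFactor₁ (wilsonDirac ρ U m r) μ ∈ Set.Icc (0 : ℝ) 1 :=
  ⟨rwFactor₁_nonneg _ μ, rwFactor₁_le_one _ μ⟩

end Wilson

end Literature.MathematicalPhysics.QuantumLattice.TwistedMass
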